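import Summits.HodgeConjecture.HodgeConjecture.Theses.SecondaryPeriods
import Summits.HodgeConjecture.HodgeConjecture.Theorems.SecondaryPeriodsLevelOneConiveauThreefoldsKnownRegime
import Literature.Barriers.HodgeConjecture.DecompositionOfTheDiagonalHodgeHolds

/-!
# F3 / BC5 witness for line `vanishing-genus` (crux `LevelOneConiveauThreefolds`, stmt-HodgeConjecture-10376)

Self-contained copy of the graded family of `Lines/vanishing-genus.lean` (`ConiveauOneAt`, `Rung`, sectors)
and the RUNG-1 statement, with the kernel-checked facts:
* `example : Rung chowSurface` — the FLOOR member of the family is a theorem of the tree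
  (`Theorems.stub_knownRegime_chowZeroOnSurface`; Bloch–Srinivas decomposition of the diagonal + Andreotti–Frankel,
  hypothesis-free) — the rung family SPECIALISES to the proved floor;
* `chowSurface_le_genusZero` — the floor's sector lies inside RUNG 1's sector (Voisin II Thm. 10.17, PROVED:
  `BlochSrinivas1983_hodgeTypeL0_vanish_of_chowZeroSupported_holds`);
* `example : VanishingGenusConiveauOne → Rung chowSurface` — RUNG 1 is at least the floor.
No `sorry`. Witness regime: threefolds with `CH₀` supported on a surface; there the relevant slice of the
summit (HC for the `(3,1)`-Künneth classes on `Y × C`) is known (Bloch–Srinivas 1983 Thm. 1(3) / Voisin II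
Prop. 10.26, in tree `curveCorrespondenceAlgebraic_of_hasChowZeroSupportedInDimLE_two`); in RUNG 1's regime
(`h^{3,0} = 0`, `CH₀` unconstrained) it is not.
-/

noncomputable section

set_option linter.dupNamespace false

namespace Summit.HodgeConjecture.HodgeConjecture.Cruxes.LevelOneConiveauThreefolds.VanishingGenus.Special

open Literature.AlgebraicGeometry Literature.AlgebraicGeometry.Motives
open Literature.AlgebraicGeometry.HodgeTheory
open Literature.Barriers.HodgeConjecture

def ConiveauOneAt (Y : SchemeOver ℂ) (A : HodgeModel 3 Y) : Prop :=
  ∀ (s : Finset (complexBetti Y 3)), (∀ c ∈ s, IsRationalClass c) →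
    (Submodule.span ℂ (↑s : Set (complexBetti Y 3))).map (A.pullback 3).hom =
      (⨆ (p : ℕ) (q : ℕ) (_ : p + q = 3),
        (Submodule.span ℂ (↑s : Set (complexBetti Y 3))).map (A.pullback 3).hom ⊓ A.hodgePQ 3 p q) →
    (Submodule.span ℂ (↑s : Set (complexBetti Y 3))).map (A.pullback 3).hom ≤
      (⨆ (p : ℕ) (q : ℕ) (_ : p + q = 3) (_ : 1 ≤ p) (_ : 1 ≤ q), A.hodgePQ 3 p q) →
    Submodule.span ℂ (↑s : Set (complexBetti Y 3)) ≤ supportedClasses Y 3 1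

def Rung (𝒞 : ∀ ⦃Y : SchemeOver ℂ⦄, IsSmoothProjective 3 Y → HodgeModel 3 Y → Prop) : Prop :=
  ∀ ⦃Y : SchemeOver ℂ⦄ (hY : IsSmoothProjective 3 Y) (A : HodgeModel 3 Y), 𝒞 hY A → ConiveauOneAt Y A

def chowSurface : ∀ ⦃Y : SchemeOver ℂ⦄, IsSmoothProjective 3 Y → HodgeModel 3 Y → Prop :=
  fun Y _ _ ↦ HasChowZeroSupportedInDimLE Y 2

def genusZero : ∀ ⦃Y : SchemeOver ℂ⦄, IsSmoothProjective 3 Y → HodgeModel 3 Y → Prop :=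
  fun _ _ A ↦ A.hodgePQ 3 3 0 = ⊥

def VanishingGenusConiveauOne : Prop :=
  ∀ ⦃Y : SchemeOver ℂ⦄, IsSmoothProjective 3 Y → ∀ (A : HodgeModel 3 Y), A.hodgePQ 3 3 0 = ⊥ →
    ∀ (s : Finset (complexBetti Y 3)), (∀ c ∈ s, IsRationalClass c) →
    (Submodule.span ℂ (↑s : Set (complexBetti Y 3))).map (A.pullback 3).hom =
      (⨆ (p : ℕ) (q : ℕ) (_ : p + q = 3),
        (Submodule.span ℂ (↑s : Set (complexBetti Y 3))).map (A.pullback 3).hom ⊓ A.hodgePQ 3 p q) →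
    (Submodule.span ℂ (↑s : Set (complexBetti Y 3))).map (A.pullback 3).hom ≤
      (⨆ (p : ℕ) (q : ℕ) (_ : p + q = 3) (_ : 1 ≤ p) (_ : 1 ≤ q), A.hodgePQ 3 p q) →
    Submodule.span ℂ (↑s : Set (complexBetti Y 3)) ≤ supportedClasses Y 3 1

/-- **F3 WITNESS.** The floor member of the graded family is PROVED (tree theorem, no hypothesis). -/
example : Rung chowSurface := by
  intro Y hY A hW s hs hsub hlev
  simpa using Theorems.stub_knownRegime_chowZeroOnSurface hY hW A s hs hsub hlev

/-- Named form of the witness. -/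
theorem rung_chowSurface : Rung chowSurface :=
  fun _ hY A hW s hs hsub hlev ↦ Theorems.stub_knownRegime_chowZeroOnSurface hY hW A s hs hsub hlev

/-- Regime inclusion FLOOR ⊆ RUNG-1 sector (Voisin II Thm. 10.17, proved in the tree). -/
theorem chowSurface_le_genusZero ⦃Y : SchemeOver ℂ⦄ (hY : IsSmoothProjective 3 Y) (A : HodgeModel 3 Y) :
    chowSurface hY A → genusZero hY A :=
  fun hW ↦ BlochSrinivas1983_hodgeTypeL0_vanish_of_chowZeroSupported_iff_hodgePQ_eq_bot.1
    BlochSrinivas1983_hodgeTypeL0_vanish_of_chowZeroSupported_holds hY hW (show 2 < 3 by norm_num) A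

/-- RUNG 1 is the member `genusZero` of the family. -/
theorem vanishingGenusConiveauOne_iff_rung : VanishingGenusConiveauOne ↔ Rung genusZero :=
  ⟨fun h _ hY A hA s hs hsub hlev ↦ h hY A hA s hs hsub hlev,
   fun h _ hY A hA s hs hsub hlev ↦ h hY A hA s hs hsub hlev⟩

/-- RUNG 1 ⇒ FLOOR: the rung specialises to (indeed implies) the proved floor. -/
example : VanishingGenusConiveauOne → Rung chowSurface :=
  fun h _ hY A hW ↦ (vanishingGenusConiveauOne_iff_rung.1 h) hY A (chowSurface_le_genusZero hY A hW)

end Summit.HodgeConjecture.HodgeConjecture.Cruxes.LevelOneConiveauThreefolds.VanishingGenus.Special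

end
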